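import Literature.Topology.FourManifolds.BallComplementFraming
import Literature.Topology.FourManifolds.StableFramingLift
import Literature.Topology.FourManifolds.SmoothOrientationProd
import HarnessLib

/-!
# Stable framings: sections of the tangent bundle of a product, push-forward, recombination

Topic `Literature/Topology/FourManifolds`; generic bundle-theoretic lemmas for the proof that
Kosinski's plumbing `M(4m)` is stably parallelisable (A. Kosinski, *Differential Manifolds* (1993),
VI.12 and IX.(7.5)): the stable framing of `T(Sᵏ × Sᵏ) ⊕ ℝ` along the core spheres is written
down in ambient coordinates, pushed to the plumbed manifold along the tube embeddings, and the
framings over the eight cores are matched at the crossing points by constant changes of frame.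

* `continuous_totalSpaceMk_prod` — a section `p ↦ (X p, Y p)` of `T(M × M')` along `(f, g)` is
  continuous if its components are continuous sections of `TM` along `f` and of `TM'` along `g`
  (the coordinate changes of `T(M × M')` are the products of those of the factors, tree's
  `tangentCoordChange_prod`).
* `HasStableTangentFramingAlong.pushforward` — **push-forward of a stable framing along a `C¹` map
  with injective differential between equidimensional manifolds** (`sᵢ ↦ dφ ∘ sᵢ`, continuity by
  the continuity of the tangent map).
* `HasStableTangentFramingAlong.of_sections_recombine` — constant invertible recombinations of
  the sections of a stable framing give a stable framing.

Everything is proved; no named facts (D-0026).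

## References

* A. Kosinski, *Differential Manifolds*, Academic Press 1993, IX §1 (stable tangent bundles),
  IX.(7.5). [Kosinski1993]
* M. W. Hirsch, *Differential Topology*, GTM 33 (1976), Ch. 4 §1–§2. [Hirsch1976]
-/

open scoped Manifold ContDiff Topology
open Set Function Module Bundle Filter

noncomputable section

namespace Literature.Topology.FourManifolds

/-! ### §1 The tangent bundle of a product -/

section Prod

variable {E : Type*} [NormedAddCommGroup E] [NormedSpace ℝ E]
  {E' : Type*} [NormedAddCommGroup E'] [NormedSpace ℝ E']
  {H : Type*} [TopologicalSpace H] {I : ModelWithCorners ℝ E H}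
  {H' : Type*} [TopologicalSpace H'] {I' : ModelWithCorners ℝ E' H'}
  {M : Type*} [TopologicalSpace M] [ChartedSpace H M] [IsManifold I 1 M]
  {M' : Type*} [TopologicalSpace M'] [ChartedSpace H' M'] [IsManifold I' 1 M']

/-- **Continuity of sections of the tangent bundle of a product**: if `p ↦ ⟨f p, X p⟩` is
continuous into `TM` and `p ↦ ⟨g p, Y p⟩` into `TM'`, then `p ↦ ⟨(f p, g p), (X p, Y p)⟩` is
continuous into `T(M × M')`. [folklore] -/
theorem continuous_totalSpaceMk_prod {S : Type*} [TopologicalSpace S] {f : S → M} {g : S → M'}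
    {X : S → E} {Y : S → E'}
    (hX : Continuous fun p => (TotalSpace.mk' E (f p) (X p) : TangentBundle I M))
    (hY : Continuous fun p => (TotalSpace.mk' E' (g p) (Y p) : TangentBundle I' M')) :
    Continuous fun p => (TotalSpace.mk' (E × E') (f p, g p) (X p, Y p) : TangentBundle (I.prod I') (M × M')) := by
  rw [continuous_iff_continuousAt]
  intro p₀
  have hX₀ := hX.continuousAt (x := p₀)
  have hY₀ := hY.continuousAt (x := p₀)
  rw [FiberBundle.continuousAt_totalSpace] at hX₀ hY₀ ⊢
  obtain ⟨hf, hX₂⟩ := hX₀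
  obtain ⟨hg, hY₂⟩ := hY₀
  refine ⟨hf.prodMk hg, ?_⟩
  -- near `p₀` both base points lie in the chart domains at `f p₀`, `g p₀`
  have hev : ∀ᶠ p in 𝓝 p₀, f p ∈ (extChartAt I (f p₀)).source ∧ g p ∈ (extChartAt I' (g p₀)).source := by
    refine (hf.eventually ((isOpen_extChartAt_source (f p₀)).mem_nhds (mem_extChartAt_source (f p₀)))).and
      (hg.eventually ((isOpen_extChartAt_source (g p₀)).mem_nhds (mem_extChartAt_source (g p₀))))
  refine (hX₂.prodMk hY₂).congr (hev.mono fun p hp => ?_)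
  change ((trivializationAt E (TangentSpace I) (f p₀) (TotalSpace.mk' E (f p) (X p))).2,
      (trivializationAt E' (TangentSpace I') (g p₀) (TotalSpace.mk' E' (g p) (Y p))).2) =
    (trivializationAt (E × E') (TangentSpace (I.prod I')) (f p₀, g p₀)
      (TotalSpace.mk' (E × E') (f p, g p) (X p, Y p))).2
  rw [trivializationAt_snd_eq_tangentCoordChange, trivializationAt_snd_eq_tangentCoordChange]
  change _ = (trivializationAt (E × E') (TangentSpace (I.prod I')) (f p₀, g p₀)
      (⟨(f p, g p), (X p, Y p)⟩ : TangentBundle (I.prod I') (M × M'))).2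
  rw [trivializationAt_snd_eq_tangentCoordChange (I := I.prod I') (f p₀, g p₀) (f p, g p) (X p, Y p),
    tangentCoordChange_prod]
  · rfl
  · refine ⟨mem_extChartAt_source (I := I.prod I') (f p, g p), ?_⟩
    rw [extChartAt_prod, PartialEquiv.prod_source]
    exact ⟨hp.1, hp.2⟩

end Prod

/-! ### §2 Push-forward of stable framings -/

section Pushforward

variable {E : Type*} [NormedAddCommGroup E] [NormedSpace ℝ E]
  {E' : Type*} [NormedAddCommGroup E'] [NormedSpace ℝ E']
  {H : Type*} [TopologicalSpace H] {I : ModelWithCorners ℝ E H}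
  {H' : Type*} [TopologicalSpace H'] {I' : ModelWithCorners ℝ E' H'}
  {M : Type*} [TopologicalSpace M] [ChartedSpace H M] [IsManifold I 1 M]
  {N : Type*} [TopologicalSpace N] [ChartedSpace H' N] [IsManifold I' 1 N]
  {S : Type*} [TopologicalSpace S]

/-- **Push-forward of a stable framing along an equidimensional `C¹` map with injective
differential**: if `TM ⊕ ℝ` is framed along `f : S → M` and `φ : M → N` is `C¹` with
`dφ` injective everywhere and `dim M = dim N`, then `TN ⊕ ℝ` is framed along `φ ∘ f` by
`(dφ (sᵢ)₁, (sᵢ)₂)` (continuity: the tangent map `Tφ` is continuous). [cite: Hirsch1976, Ch. 4 §1] -/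
theorem HasStableTangentFramingAlong.pushforward {φ : M → N} (hφ : ContMDiff I I' 1 φ)
    (hinj : ∀ x, Injective (mfderiv I I' φ x)) (hdim : finrank ℝ E = finrank ℝ E')
    {f : S → M} (hs : HasStableTangentFramingAlong I M f) :
    HasStableTangentFramingAlong I' N (φ ∘ f) := by
  obtain ⟨s, hsc, hsc', hli⟩ := hs
  refine ⟨fun i p => (mfderiv I I' φ (f p) (s (Fin.cast (by rw [hdim]) i) p).1,
    (s (Fin.cast (by rw [hdim]) i) p).2), fun i => ?_, fun i => hsc' _, fun p => ?_⟩
  · have ht := hφ.continuous_tangentMap le_rfl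
    exact (ht.comp (hsc (Fin.cast (by rw [hdim]) i))).congr fun p => rfl
  · -- linear independence: apply the injective linear map `dφ × id`
    set A : (E × ℝ) →ₗ[ℝ] (E' × ℝ) :=
      ((mfderiv I I' φ (f p)).toLinearMap.comp (LinearMap.fst ℝ E ℝ)).prod (LinearMap.snd ℝ E ℝ) with hA
    have hAinj : LinearMap.ker A = ⊥ := by
      rw [LinearMap.ker_eq_bot]
      rintro ⟨v, a⟩ ⟨v', a'⟩ h
      have h1 : mfderiv I I' φ (f p) v = mfderiv I I' φ (f p) v' := congrArg Prod.fst h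
      have h2 : a = a' := congrArg Prod.snd h
      exact Prod.ext (hinj (f p) h1) h2
    have h1 := (hli p).map' A hAinj
    have h2 : LinearIndependent ℝ ((A ∘ fun i => s i p) ∘ Fin.cast (by rw [hdim])) :=
      h1.comp _ (Fin.cast_injective _)
    convert h2 using 1
    funext i
    rfl

end Pushforward

/-! ### §3 Recombination of stable framings by constant invertible matrices -/

section Recombine

variable {E : Type*} [NormedAddCommGroup E] [NormedSpace ℝ E]
  {H : Type*} [TopologicalSpace H] {I : ModelWithCorners ℝ E H}
  {M : Type*} [TopologicalSpace M] [ChartedSpace H M] [IsManifold I 1 M]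
  {S : Type*} [TopologicalSpace S]

/-- **Stable sections recombined by a constant matrix are stable sections**: for sections
`sⱼ = (vⱼ, aⱼ)` of `f*TM ⊕ ℝ` with `vⱼ` continuous into `TM` and `aⱼ` continuous, and a real
matrix `g`, the sections `tᵢ = Σⱼ gⱼᵢ sⱼ` have the same continuity properties. [folklore] -/
theorem continuous_recombine {ι κ : Type*} [Fintype ι] {f : S → M} (hf : Continuous f)
    {s : ι → S → E × ℝ}
    (hsc : ∀ j, Continuous fun p => (TotalSpace.mk' E (f p) (s j p).1 : TangentBundle I M))
    (hsc' : ∀ j, Continuous fun p => (s j p).2) (g : ι → κ → ℝ) (i : κ) :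
    (Continuous fun p => (TotalSpace.mk' E (f p) (∑ j, g j i • s j p).1 : TangentBundle I M)) ∧
      Continuous fun p => (∑ j, g j i • s j p).2 := by
  constructor
  · have h := continuous_sum_smul_along (I := I) hf Finset.univ (φ := fun j (_ : S) => g j i)
      (v := fun j p => (s j p).1) (fun j _ => continuous_const) (fun j _ => hsc j)
    have key : ∀ p, (∑ j, g j i • s j p).1 = ∑ j, g j i • (s j p).1 := fun p => by
      simp only [Prod.fst_sum, Prod.smul_fst]
    refine h.congr fun p => ?_
    rw [key]
    rfl
  · have : (fun p => (∑ j, g j i • s j p).2) = fun p => ∑ j, g j i * (s j p).2 := by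
      funext p; simp only [Prod.snd_sum, Prod.smul_snd, smul_eq_mul]
    rw [this]
    exact continuous_finsetSum _ fun j _ => continuous_const.mul (hsc' j)

/-- **Prescribing the value of a stable framing at one point**: if `TM ⊕ ℝ` is framed along `f`
(with `dim M + 1` sections) and `b` is any basis of `E × ℝ`, then there is a framing along `f`
whose value at a given `p₀` is `b` (recombine by the constant matrix expressing `b` in the frame
at `p₀`). [folklore] -/
theorem HasStableTangentFramingAlong.exists_eq_at [FiniteDimensional ℝ E] {f : S → M} (hf : Continuous f)
    (h : HasStableTangentFramingAlong I M f) (p₀ : S)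
    (b : Module.Basis (Fin (finrank ℝ E + 1)) ℝ (E × ℝ)) :
    ∃ t : Fin (finrank ℝ E + 1) → S → E × ℝ,
      (∀ i, Continuous fun p => (TotalSpace.mk' E (f p) (t i p).1 : TangentBundle I M)) ∧
      (∀ i, Continuous fun p => (t i p).2) ∧ (∀ p, LinearIndependent ℝ fun i => t i p) ∧
      ∀ i, t i p₀ = b i := by
  obtain ⟨s, hsc, hsc', hli⟩ := h
  -- the frame at `p₀` is a basis
  have hcard : Fintype.card (Fin (finrank ℝ E + 1)) = finrank ℝ (E × ℝ) := by
    rw [Fintype.card_fin, Module.finrank_prod, Module.finrank_self]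
  let b₀ : Module.Basis (Fin (finrank ℝ E + 1)) ℝ (E × ℝ) := basisOfLinearIndependentOfCardEqFinrank (hli p₀) hcard
  have hb₀ : ∀ j, b₀ j = s j p₀ := fun j => by
    simp only [b₀, coe_basisOfLinearIndependentOfCardEqFinrank]
  -- the matrix `g j i = (b₀.repr (b i)) j`
  let g : Fin (finrank ℝ E + 1) → Fin (finrank ℝ E + 1) → ℝ := fun j i => b₀.repr (b i) j
  refine ⟨fun i p => ∑ j, g j i • s j p, fun i => (continuous_recombine hf hsc hsc' g i).1,
    fun i => (continuous_recombine hf hsc hsc' g i).2, fun p => ?_, fun i => ?_⟩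
  · -- linear independence at `p`: the matrix `g` is invertible (it maps the basis `b₀` to `b`)
    let bp : Module.Basis (Fin (finrank ℝ E + 1)) ℝ (E × ℝ) := basisOfLinearIndependentOfCardEqFinrank (hli p) hcard
    have hbp : ∀ j, bp j = s j p := fun j => by simp only [bp, coe_basisOfLinearIndependentOfCardEqFinrank]
    -- the linear automorphism `L` of `E × ℝ` with `L (b₀ j) = bp j` sends `b i` to `t i p`
    let L : (E × ℝ) →ₗ[ℝ] (E × ℝ) := b₀.constr ℝ fun j => bp j
    have hL : ∀ i, L (b i) = ∑ j, g j i • s j p := by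
      intro i
      conv_lhs => rw [← b₀.sum_repr (b i)]
      simp only [map_sum, map_smul, L, Module.Basis.constr_basis, hbp, g]
    have hLinj : LinearMap.ker L = ⊥ := by
      -- `L` maps a basis to a basis
      have : L = (b₀.equiv bp (Equiv.refl _)).toLinearMap := by
        refine b₀.ext fun j => ?_
        simp only [L, Module.Basis.constr_basis, LinearEquiv.coe_coe, Module.Basis.equiv_apply, Equiv.refl_apply]
      rw [this]; exact LinearEquiv.ker _
    have h1 := b.linearIndependent.map' L hLinj
    change LinearIndependent ℝ (fun i => ∑ j, g j i • s j p)
    rw [show (fun i => ∑ j, g j i • s j p) = ⇑L ∘ ⇑b from funext fun i => (hL i).symm]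
    exact h1
  · -- the value at `p₀`
    change ∑ j, g j i • s j p₀ = b i
    conv_rhs => rw [← b₀.sum_repr (b i)]
    simp only [hb₀, g]

end Recombine

end Literature.Topology.FourManifolds
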